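import Summits.RiemannHypothesis.RiemannHypothesis.Theorems.PfPersistenceGapClassG1
import HarnessLib

/-!
# PF persistence — the REFLEXIVE-COUPLING LABEL (RULING A98 (b1), optional typer item)
(pub-rhpf barrier-typer gen 5; append to MEMBERSHIP.md R16)

**HONEST FRAMING. This is a long-odds MECHANISM SEARCH; no RH claims.** A LABEL lemma, not a membership clause:
a coupling-tier criterion is filed with its coupling functional `F : Datum → Set Datum` (the criterion at the
reference datum `d₀` is `F d₀`); `F` is REFLEXIVE iff every datum passes its own criterion, `∀ d, d ∈ F d`.  For a
reflexive `F` the clause "`ζ ∈ F ζ`" (A0 clause C4) holds BY CONSTRUCTION — it is the author's slack, not a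
measurement (`ReflexiveCoupling.self_mem`).  The open coupling tube `T_s[d₀] = {d | ∀ win, d(win) − d₀(win) + s(win)·1 ≻ 0}`
of cand-6 (`Theorems/PfPersistenceLoewnerAntichain.lean`, `zeta_mem_tube`) is reflexive for every positive slack
(`reflexiveCoupling_tube`).
-/

set_option linter.dupNamespace false

namespace Summit.RiemannHypothesis.RiemannHypothesis.Theorems.PfPersistence

open Matrix

/-- A coupling functional `F : Datum → Set Datum` is REFLEXIVE iff every datum passes its own criterion. -/
def ReflexiveCoupling (F : Datum → Set Datum) : Prop :=
  ∀ d : Datum, d ∈ F d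

/-- PROVED (the label): for a reflexive coupling, the reference datum passes — in particular `ζ ∈ F ζ`
(clause C4 by construction). [folklore] -/
theorem ReflexiveCoupling.self_mem {F : Datum → Set Datum} (hF : ReflexiveCoupling F) (d₀ : Datum) : d₀ ∈ F d₀ :=
  hF d₀

/-- PROVED: `ζ` passes every reflexive coupling criterion centred at `ζ`. [folklore] -/
theorem ReflexiveCoupling.zeta_mem {F : Datum → Set Datum} (hF : ReflexiveCoupling F) : zetaDatum ∈ F zetaDatum :=
  hF zetaDatum

/-- The open coupling tube of slack `s` centred at `d₀` (cand-6's `T_s`, with the centre made a parameter). -/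
def couplingTube (s : Window → ℝ) (d₀ : Datum) : Set Datum :=
  {d : Datum | ∀ win : Window, WindowStrictlyPositive
    (d win - d₀ win + s win • (1 : Matrix (Fin (win.N + 1)) (Fin (win.N + 1)) ℝ))}

/-- PROVED: the tube coupling is REFLEXIVE for every positive slack (the proof of `zeta_mem_tube`, verbatim with a
general centre). [folklore] -/
theorem reflexiveCoupling_tube {s : Window → ℝ} (hs : ∀ win, 0 < s win) : ReflexiveCoupling (couplingTube s) := by
  intro d win v hv
  rw [sub_self, zero_add, Matrix.smul_mulVec, Matrix.one_mulVec, dotProduct_smul, smul_eq_mul]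
  exact mul_pos (hs win)
    (lt_of_le_of_ne (dotProduct_self_nonneg_real v) fun h => hv (dotProduct_self_eq_zero.1 h.symm))

end Summit.RiemannHypothesis.RiemannHypothesis.Theorems.PfPersistence
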